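import Literature.NumberTheory.EllipticCurves.SigmaODELogDerivProofs
import Literature.NumberTheory.EllipticCurves.FormalGroupHasseInvariantProofs
import Literature.NumberTheory.EllipticCurves.FormalGroupNegOmegaProofs
import Literature.NumberTheory.EllipticCurves.FormalMulTwoSecondCoeffProofs
import HarnessLib

/-!
# The quasi-period function `η₀` of a Weierstrass formal group (the differential of the second
# kind `x ω`) and its addition cocycle

Topic `Literature/NumberTheory/EllipticCurves`; dot-notation extensions of `WeierstrassCurve`.
Companion of `FormalGroup.lean` (`log_W = ∫ ω`) for the SECOND de Rham class of an elliptic curve.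

For a Weierstrass equation `W` over a commutative ring `R`, in the parameter `z = -x/y` at `O`
(`X = z²x(z) = formalXMulSq`, `ω = formalInvDiff = (1 + a₁z + ⋯)dz`, Silverman AEC IV.1), the
differential of the second kind `x ω` (regular away from `O`, double pole without residue at `O`;
with `ω = dx/(2y + a₁x + a₃)` the pair `(ω, xω)` is the classical basis of `H¹_dR(E)`; over `ℂ`,
`x ω = ℘(u)du` up to the constant `b₂/12`) expands as

  `x(z) ω(z)/dz = z⁻² + g_W(z)`,  `g_W ∈ R⟦z⟧` (no `z⁻¹` term: the coefficients of `z⁰, z¹` of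
  `X·ω` are `1, 0`),

so that over a `ℚ`-algebra its primitive is `∫ x ω = -1/z + η₀(z)` with the **quasi-period function**

  `η₀ = formalQuasiPeriod W := ∫₀ᶻ g_W ∈ A⟦z⟧`   (`η₀ = (a₃/2)z² + ⋯`; over `ℂ`: `-ζ(u) + 1/z - (b₂/12)u + a₁/2`).

This file defines `g_W` (`formalQuasiPeriodIntegrand`, over ANY ring — it is integral), `η₀` and the
**addition cocycle** `C₀(u, v) = η₀(u +_F v) - η₀(u) - η₀(v) ∈ A⟦u, v⟧` (`formalQuasiPeriodCocycle`,
`F = formalGroupLaw` the chord–tangent law of AEC IV.1), and proves the calculus that drives them: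

* `X_sq_mul_formalQuasiPeriodIntegrand` — `z²·g_W = X·ω - 1`;
* `derivative_formalQuasiPeriod` — `dη₀/dz = g_W`, and
  `X_sq_mul_formalInvariantDerivation_formalQuasiPeriod` — **`z²·Dη₀ = X - η`** for the invariant
  derivation `D = d/ω = η·d/dz` (`formalInvariantDerivation`, `η = formalEta = dz/ω`), i.e.
  `D η₀ = x - (dz/ω)/z²` — the pole-free form of `D(∫xω) = x`;
* `formalInvariantDerivationMv_formalQuasiPeriodCocycle` — `D₁C₀ = (Dη₀)(u +_F v) - (Dη₀)(u)` (the
  invariance `D₁(h(u +_F v)) = (Dh)(u +_F v)` of the tree, `SigmaODELogDerivProofs`), and its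
  pole-cleared form `X_sq_mul_formalGroupLaw_sq_mul_formalInvariantDerivationMv_cocycle`:
  `u²F²·D₁C₀ = u²·(X - η)(F) - F²·(X - η)(u)`.

and STATES (named fact, nothing asserted) the **pseudo-addition theorem for `η₀`**
(`formalQuasiPeriod_addition`): with `N = X(u)v² - X(v)u²` (`= u²v²(x₁ - x₂)`) and
`M = X(v)u³ - X(u)v³` (`= u³v³(y₁ - y₂)`),

  `u·v·N·F · C₀ = u·v·N - (u + v)·N·F - M·F`,

i.e. `η₀(u +_F v) - η₀(u) - η₀(v) = -(y₁ - y₂)/(x₁ - x₂) + 1/F - 1/u - 1/v` — the Frobenius–Stickelberger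
pseudo-addition formula `ζ(u+v) - ζ(u) - ζ(v) = ½(℘'(u) - ℘'(v))/(℘(u) - ℘(v))` of the Weierstrass
zeta function (Whittaker–Watson §20·41) transported to the formal group of a general Weierstrass
equation (`∫xω = -ζ + const·log + a₁/2` in the complex uniformisation; the `a₁/2` is absorbed by the
normalisation `η₀(0) = 0`, so NO constant appears). Its proof in the tree's language (the
`D₁`-Wronskian method of `CanonicalPAdicHeightThetaFormalProofs`: both sides have the same
`D₁`-derivative up to the factor `u v N F`, by `D₁λ = x₁ - x₃` on `E × E`, and the same expansion to
order `u²`) is left to a sequel; the identity was checked coefficientwise to total degree 11 on random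
integral equations by exact rational arithmetic before being stated. Consequence used downstream
(Katz 1981 §5.1: `η₀` is a quasi-logarithm, `dη₀` and `C₀` INTEGRAL, so `(log_W, η₀)` spans the
Dieudonné module `D(Ŵ/R) ≅ H¹_dR(E/R)`): the `η`-PERIOD `∫_t η = lim pⁿ η₀(ûₙ) ∈ B_dR⁺` of a
`p`-power-compatible sequence of torsion points (Colmez 1992 §2), the second half of the de Rham
period pairing of `Ŵ` next to `∫_t ω = log_W([t])` (`PAdicHodge/AinfWeierstrassOmegaPeriod`).

Why here (BSD, crux K★ `stmt-BirchSwinnertonDyer-22226`, hDR sector (iii)): de Rham-ness of `V_pE`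
at a potentially supersingular prime needs TWO independent de Rham periods; the `ω`-period is in the
tree, this is the algebra of the `η`-period. BSD is not proved by any of this.

## References
* J. H. Silverman, *The Arithmetic of Elliptic Curves*, 2nd ed. (2009), IV.1 (expansions of `x(z)`,
  `y(z)`, `ω(z)`), III.2.3 (group law: `x₃ = λ² + a₁λ - a₂ - x₁ - x₂`). [SilvermanAEC2009]
* E. T. Whittaker, G. N. Watson, *A Course of Modern Analysis*, 4th ed. (1927), §20·41 (the
  pseudo-addition formula for `ζ`). [WhittakerWatson1927]
* N. M. Katz, *Crystalline cohomology, Dieudonné modules, and Jacobi sums* (1981), §5.1–§5.2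
  (`D(G/R) = {f : f(0) = 0, df integral, f(X +_G Y) - f(X) - f(Y) integral}/{integral f}`).
* P. Colmez, *Périodes p-adiques des variétés abéliennes*, Math. Ann. 292 (1992), §2.
* C. Blakestad, D. Grant, J. Number Theory 249 (2023), §2–§3 (`D = d/ω`, `D₁`, the universal
  `p`-adic Weierstrass zeta function `ζ = D log σ`, `Dζ = -x + β`). [BlakestadGrant2023]

## Design notes
* `g_W` is defined over every commutative ring from the INTEGRAL invariant differential
  `formalInvDiff = η⁻¹` (so `dη₀/dz` is manifestly integral and commutes with base change,
  `map_formalQuasiPeriodIntegrand`); `η₀` needs a `ℚ`-algebra (division by `n + 1`), exactly like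
  `formalLog`.
* No instance, no notation, no `sorry`; one named fact (`formalQuasiPeriod_addition`, a `def … : Prop`).
-/

noncomputable section

open PowerSeries Literature.NumberTheory.EllipticCurves

namespace WeierstrassCurve

variable {R : Type*} [CommRing R] (W : WeierstrassCurve R)

/-! ### The integrand `g_W = (X·ω - 1)/z²` over any ring -/

/-- **`g_W(z) = (X(z)·ω(z)/dz - 1)/z² ∈ R⟦z⟧`**, i.e. `x(z) ω(z) = (z⁻² + g_W(z)) dz`: the expansion
of the differential of the second kind `x ω` at `O` with its (residue-free) double pole removed;
coefficientwise, `coeff n g_W = coeff (n + 2) (X·ω)` (`X = z²x`, `ω = formalInvDiff`).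
[Silverman AEC IV.1 (expansions of `x(z)` and `ω(z)`); Katz 1981 §5.1] [cite: SilvermanAEC2009, IV.1.1] -/
def formalQuasiPeriodIntegrand : R⟦X⟧ :=
  PowerSeries.mk fun n => coeff (n + 2) (W.formalXMulSq * W.formalInvDiff)

/-- Unfolding: `coeff n g_W = coeff (n + 2) (X·ω)`. [cite: SilvermanAEC2009, IV.1.1] -/
theorem coeff_formalQuasiPeriodIntegrand (n : ℕ) :
    coeff n W.formalQuasiPeriodIntegrand = coeff (n + 2) (W.formalXMulSq * W.formalInvDiff) := by
  rw [formalQuasiPeriodIntegrand, coeff_mk]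

/-- `X·ω` has constant term `1` (`X = 1 - a₁z - ⋯`, `ω = (1 + a₁z + ⋯)dz`). [Silverman AEC IV.1] [cite: SilvermanAEC2009, IV.1.1] -/
theorem constantCoeff_formalXMulSq_mul_formalInvDiff :
    constantCoeff (W.formalXMulSq * W.formalInvDiff) = 1 := by
  rw [map_mul, constantCoeff_formalXMulSq, constantCoeff_formalInvDiff, mul_one]

/-- **`x ω` has no residue at `O`**: the `z¹`-coefficient of `X·ω` is `-a₁ + a₁ = 0`.
[Silverman AEC IV.1] [cite: SilvermanAEC2009, IV.1.1] -/
theorem coeff_one_formalXMulSq_mul_formalInvDiff :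
    coeff 1 (W.formalXMulSq * W.formalInvDiff) = 0 := by
  rw [PowerSeries.coeff_mul, Finset.Nat.antidiagonal_succ, Finset.sum_cons,
    Finset.Nat.antidiagonal_zero, Finset.map_singleton, Finset.sum_singleton]
  simp only [Function.Embedding.coe_prodMap, Function.Embedding.coeFn_mk, Prod.map_apply,
    Nat.succ_eq_add_one, zero_add, Function.Embedding.refl_apply, coeff_zero_eq_constantCoeff,
    constantCoeff_formalXMulSq, constantCoeff_formalInvDiff, coeff_one_formalXMulSq,
    coeff_one_formalInvDiff]
  ring

/-- **`z²·g_W = X·ω - 1`.** [Silverman AEC IV.1] [cite: SilvermanAEC2009, IV.1.1] -/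
theorem X_sq_mul_formalQuasiPeriodIntegrand :
    X ^ 2 * W.formalQuasiPeriodIntegrand = W.formalXMulSq * W.formalInvDiff - 1 := by
  ext n
  rw [PowerSeries.coeff_X_pow_mul', map_sub, coeff_one]
  rcases Nat.lt_or_ge n 2 with hn | hn
  · rw [if_neg (Nat.not_le.mpr hn)]
    interval_cases n
    · rw [if_pos rfl, coeff_zero_eq_constantCoeff, constantCoeff_formalXMulSq_mul_formalInvDiff, sub_self]
    · rw [if_neg one_ne_zero, coeff_one_formalXMulSq_mul_formalInvDiff, sub_zero]
  · rw [if_pos hn, coeff_formalQuasiPeriodIntegrand, Nat.sub_add_cancel hn,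
      if_neg (by omega), sub_zero]

/-- `g_W` commutes with base change (its coefficients lie in `ℤ[a₁, …, a₆]`). [cite: SilvermanAEC2009, IV.1.1] -/
theorem map_formalQuasiPeriodIntegrand {S : Type*} [CommRing S] (φ : R →+* S) :
    PowerSeries.map φ W.formalQuasiPeriodIntegrand = (W.map φ).formalQuasiPeriodIntegrand := by
  ext n
  rw [coeff_map, coeff_formalQuasiPeriodIntegrand, coeff_formalQuasiPeriodIntegrand,
    ← W.map_formalXMulSq φ, ← W.map_formalInvDiff φ, ← map_mul, coeff_map]

/-- **`η·(X·ω) = X`** (`η ω = 1`). [cite: SilvermanAEC2009, IV.1.1] -/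
theorem formalEta_mul_formalXMulSq_mul_formalInvDiff :
    W.formalEta * (W.formalXMulSq * W.formalInvDiff) = W.formalXMulSq := by
  rw [mul_left_comm, W.formalEta_mul_formalInvDiff, mul_one]

/-! ### Over a `ℚ`-algebra: the quasi-period function `η₀ = ∫ g_W` -/

section RatAlgebra

variable {A : Type*} [CommRing A] [Algebra ℚ A] (V : WeierstrassCurve A)

/-- **The quasi-period function `η₀(z) = ∫₀ᶻ g_V ∈ A⟦z⟧`** of a Weierstrass equation over a
`ℚ`-algebra: the regular part of the primitive `∫ x ω = -1/z + η₀(z)` of the differential of the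
second kind `x ω`, normalised by `η₀(0) = 0` (termwise integration of `formalQuasiPeriodIntegrand`).
Over `ℂ` (`ω = du`): `η₀ = -ζ(u) + 1/z - (b₂/12)u + a₁/2`. [Whittaker–Watson §20·4 (`ζ`); Katz 1981
§5.1 (quasi-logarithms); Colmez 1992 §2] [cite: WhittakerWatson1927, §20.41] -/
def formalQuasiPeriod : A⟦X⟧ :=
  PowerSeries.mk fun n =>
    match n with
    | 0 => 0
    | n + 1 => algebraMap ℚ A (1 / (n + 1 : ℚ)) * coeff n V.formalQuasiPeriodIntegrand

/-- `η₀(0) = 0`. [cite: Katz1981CrystallineDieudonne, §5.1] -/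
@[simp] theorem constantCoeff_formalQuasiPeriod : constantCoeff V.formalQuasiPeriod = 0 := by
  rw [← coeff_zero_eq_constantCoeff_apply, formalQuasiPeriod, coeff_mk]

/-- `coeff (n+1) η₀ = coeff n g / (n + 1)`. [cite: Katz1981CrystallineDieudonne, §5.1] -/
theorem coeff_succ_formalQuasiPeriod (n : ℕ) :
    coeff (n + 1) V.formalQuasiPeriod =
      algebraMap ℚ A (1 / (n + 1 : ℚ)) * coeff n V.formalQuasiPeriodIntegrand := by
  rw [formalQuasiPeriod, coeff_mk]

/-- **`dη₀/dz = g_V`**: `η₀` is the termwise primitive of the integrand. [cite: Katz1981CrystallineDieudonne, §5.1] -/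
theorem derivative_formalQuasiPeriod : d⁄dX A V.formalQuasiPeriod = V.formalQuasiPeriodIntegrand := by
  ext n
  rw [coeff_derivative, coeff_succ_formalQuasiPeriod]
  have h : (algebraMap ℚ A) (1 / (n + 1 : ℚ)) * ((n : A) + 1) = 1 := by
    have h2 : ((n : A) + 1) = algebraMap ℚ A (n + 1 : ℚ) := by
      rw [map_add, map_natCast, map_one]
    rw [h2, ← map_mul, one_div_mul_cancel (by positivity), map_one]
  calc (algebraMap ℚ A) (1 / (n + 1 : ℚ)) * coeff n V.formalQuasiPeriodIntegrand * ((n : A) + 1)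
      = ((algebraMap ℚ A) (1 / (n + 1 : ℚ)) * ((n : A) + 1)) * coeff n V.formalQuasiPeriodIntegrand := by
        ring
    _ = coeff n V.formalQuasiPeriodIntegrand := by rw [h, one_mul]

/-- `Dη₀ = η·g_V` for the invariant derivation `D = η·d/dz`. [Blakestad–Grant 2023, §3 (`D = d/ω`)] [cite: BlakestadGrant2023, Thm. 2] -/
theorem formalInvariantDerivation_formalQuasiPeriod :
    V.formalInvariantDerivation V.formalQuasiPeriod = V.formalEta * V.formalQuasiPeriodIntegrand := by
  rw [formalInvariantDerivation_apply, derivative_formalQuasiPeriod]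

/-- **`z²·Dη₀ = X - η`**, i.e. `D η₀ = x(z) - (dz/ω)/z²`: the pole-free form of `D(∫ x ω) = x`
(`∫xω = -1/z + η₀` and `D(-1/z) = η/z²`). [Katz 1981 §5.1; Blakestad–Grant 2023, Thm. 2 (`Dζ = -x + β`)]
[cite: BlakestadGrant2023, Thm. 2] -/
theorem X_sq_mul_formalInvariantDerivation_formalQuasiPeriod :
    X ^ 2 * V.formalInvariantDerivation V.formalQuasiPeriod = V.formalXMulSq - V.formalEta := by
  rw [formalInvariantDerivation_formalQuasiPeriod, mul_left_comm, X_sq_mul_formalQuasiPeriodIntegrand,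
    mul_sub, mul_one, formalEta_mul_formalXMulSq_mul_formalInvDiff]

/-! ### The addition cocycle `C₀(u, v) = η₀(u +_F v) - η₀(u) - η₀(v)` -/

/-- **The addition cocycle of `η₀`**: `C₀(u, v) = η₀(F(u, v)) - η₀(u) - η₀(v) ∈ A⟦u, v⟧`
(`u = X 0`, `v = X 1`, `F = formalGroupLaw` the chord–tangent formal group law). By the pseudo-addition
theorem (`formalQuasiPeriod_addition`) it is `-λ + 1/F - 1/u - 1/v` (`λ` the chord slope) and has
coefficients in `ℤ[a₁, …, a₆]` — `η₀` is a quasi-logarithm in the sense of Katz.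
[Katz 1981 §5.1 (`∂f = f(X +_G Y) - f(X) - f(Y)`)] [cite: WhittakerWatson1927, §20.41] -/
def formalQuasiPeriodCocycle : MvPowerSeries (Fin 2) A :=
  V.formalQuasiPeriod.subst V.formalGroupLaw -
    V.formalQuasiPeriod.subst (MvPowerSeries.X 0 : MvPowerSeries (Fin 2) A) -
    V.formalQuasiPeriod.subst (MvPowerSeries.X 1 : MvPowerSeries (Fin 2) A)

/-- Unfolding `formalQuasiPeriodCocycle`. [cite: Katz1981CrystallineDieudonne, §5.1] -/
theorem formalQuasiPeriodCocycle_def : V.formalQuasiPeriodCocycle =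
    V.formalQuasiPeriod.subst V.formalGroupLaw -
      V.formalQuasiPeriod.subst (MvPowerSeries.X 0 : MvPowerSeries (Fin 2) A) -
      V.formalQuasiPeriod.subst (MvPowerSeries.X 1 : MvPowerSeries (Fin 2) A) := rfl

/-- `C₀` has no constant term. [cite: Katz1981CrystallineDieudonne, §5.1] -/
theorem constantCoeff_formalQuasiPeriodCocycle :
    MvPowerSeries.constantCoeff V.formalQuasiPeriodCocycle = 0 := by
  rw [formalQuasiPeriodCocycle, map_sub, map_sub,
    constantCoeff_powerSeries_subst_eq_zero V.constantCoeff_formalGroupLaw V.constantCoeff_formalQuasiPeriod,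
    constantCoeff_powerSeries_subst_eq_zero (MvPowerSeries.constantCoeff_X 0) V.constantCoeff_formalQuasiPeriod,
    constantCoeff_powerSeries_subst_eq_zero (MvPowerSeries.constantCoeff_X 1) V.constantCoeff_formalQuasiPeriod,
    sub_zero, sub_zero]

variable [IsDomain A]

/-- **`D₁C₀ = (Dη₀)(u +_F v) - (Dη₀)(u)`**: the invariant derivation `D₁ = η(u)∂/∂u` acts on functions
of `u +_F v` as `D` (tree `formalInvariantDerivationMv_subst_formalGroupLaw`), on functions of `u` as `D`,
and kills functions of `v`. [Blakestad–Grant 2023, §3] [cite: BlakestadGrant2023, §3] -/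
theorem formalInvariantDerivationMv_formalQuasiPeriodCocycle :
    V.formalInvariantDerivationMv 0 V.formalQuasiPeriodCocycle =
      (V.formalInvariantDerivation V.formalQuasiPeriod).subst V.formalGroupLaw -
        (V.formalInvariantDerivation V.formalQuasiPeriod).subst
          (MvPowerSeries.X 0 : MvPowerSeries (Fin 2) A) := by
  rw [formalQuasiPeriodCocycle, map_sub, map_sub, V.formalInvariantDerivationMv_subst_formalGroupLaw,
    V.formalInvariantDerivationMv_subst_X_zero, V.formalInvariantDerivationMv_subst_X_one, sub_zero]

/-- **`u²·F²·D₁C₀ = u²·(X - η)(F) - F²·(X - η)(u)`** — `D₁C₀ = x(u +_F v) - x(u) - η(F)/F² + η(u)/u²`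
with poles cleared (`z²·Dη₀ = X - η` substituted at `F` and at `u`). [cite: BlakestadGrant2023, §3] -/
theorem X_sq_mul_formalGroupLaw_sq_mul_formalInvariantDerivationMv_cocycle :
    (MvPowerSeries.X 0 : MvPowerSeries (Fin 2) A) ^ 2 * V.formalGroupLaw ^ 2 *
        V.formalInvariantDerivationMv 0 V.formalQuasiPeriodCocycle =
      (MvPowerSeries.X 0 : MvPowerSeries (Fin 2) A) ^ 2 *
          (V.formalXMulSq - V.formalEta).subst V.formalGroupLaw -
        V.formalGroupLaw ^ 2 *
          (V.formalXMulSq - V.formalEta).subst (MvPowerSeries.X 0 : MvPowerSeries (Fin 2) A) := by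
  have h := V.X_sq_mul_formalInvariantDerivation_formalQuasiPeriod
  have hF := congrArg (PowerSeries.subst V.formalGroupLaw) h
  have hu := congrArg (PowerSeries.subst (MvPowerSeries.X 0 : MvPowerSeries (Fin 2) A)) h
  rw [PowerSeries.subst_mul V.hasSubst_formalGroupLaw, PowerSeries.subst_pow V.hasSubst_formalGroupLaw,
    PowerSeries.subst_X V.hasSubst_formalGroupLaw] at hF
  rw [PowerSeries.subst_mul (PowerSeries.HasSubst.X 0), PowerSeries.subst_pow (PowerSeries.HasSubst.X 0),
    PowerSeries.subst_X (PowerSeries.HasSubst.X 0)] at hu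
  rw [formalInvariantDerivationMv_formalQuasiPeriodCocycle, mul_sub, ← hF, ← hu]
  ring

end RatAlgebra

/-! ### Named fact: the pseudo-addition theorem for `η₀` (nothing asserted) -/

/-- **The pseudo-addition theorem for the quasi-period function** (Frobenius–Stickelberger /
Whittaker–Watson `ζ(u+v) - ζ(u) - ζ(v) = ½(℘'(u) - ℘'(v))/(℘(u) - ℘(v))`, transported to the formal
group of a general Weierstrass equation over a `ℚ`-algebra): in `A⟦u, v⟧`, with `X = z²x(z)`,
`F = u +_F v` the chord–tangent formal group law, `C₀ = η₀(F) - η₀(u) - η₀(v)`,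
`N = X(u)v² - X(v)u²` (`= u²v²(x₁ - x₂)`) and `M = X(v)u³ - X(u)v³` (`= u³v³(y₁ - y₂)`):

  `u·v·N·F·C₀ = u·v·N - (u + v)·N·F - M·F`,

i.e. `η₀(u +_F v) - η₀(u) - η₀(v) = -(y₁ - y₂)/(x₁ - x₂) + 1/F - 1/u - 1/v` with all poles cleared
(in the complex uniformisation `∫xω = -ζ(u) + 1/z - (b₂/12)u + a₁/2` up to the normalisation
`η₀(0) = 0`, and `(y₁ - y₂)/(x₁ - x₂) = ½(℘'₁ - ℘'₂)/(℘₁ - ℘₂) - a₁/2`). Stated, not proved: the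
tree's route is the `D₁`-Wronskian method of `CanonicalPAdicHeightThetaFormalProofs` (both sides have
proportional `D₁`-derivatives by `D₁λ = x₁ - x₃` on `E × E`, and agree to order `u²`); checked
coefficientwise to total degree `11` on random integral equations by exact arithmetic.
[Whittaker–Watson §20·41; Silverman AEC III.2.3, IV.1] [cite: WhittakerWatson1927, §20.41] -/
def formalQuasiPeriod_addition : Prop :=
  ∀ {A : Type} [CommRing A] [Algebra ℚ A] (V : WeierstrassCurve A),
    (MvPowerSeries.X 0 : MvPowerSeries (Fin 2) A) * MvPowerSeries.X 1 *
          (V.formalXMulSq.subst (MvPowerSeries.X 0 : MvPowerSeries (Fin 2) A) * MvPowerSeries.X 1 ^ 2 -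
            V.formalXMulSq.subst (MvPowerSeries.X 1 : MvPowerSeries (Fin 2) A) * MvPowerSeries.X 0 ^ 2) *
          V.formalGroupLaw * V.formalQuasiPeriodCocycle =
      (MvPowerSeries.X 0 : MvPowerSeries (Fin 2) A) * MvPowerSeries.X 1 *
          (V.formalXMulSq.subst (MvPowerSeries.X 0 : MvPowerSeries (Fin 2) A) * MvPowerSeries.X 1 ^ 2 -
            V.formalXMulSq.subst (MvPowerSeries.X 1 : MvPowerSeries (Fin 2) A) * MvPowerSeries.X 0 ^ 2) -
        (MvPowerSeries.X 0 + MvPowerSeries.X 1) *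
          (V.formalXMulSq.subst (MvPowerSeries.X 0 : MvPowerSeries (Fin 2) A) * MvPowerSeries.X 1 ^ 2 -
            V.formalXMulSq.subst (MvPowerSeries.X 1 : MvPowerSeries (Fin 2) A) * MvPowerSeries.X 0 ^ 2) *
          V.formalGroupLaw -
        (V.formalXMulSq.subst (MvPowerSeries.X 1 : MvPowerSeries (Fin 2) A) * MvPowerSeries.X 0 ^ 3 -
            V.formalXMulSq.subst (MvPowerSeries.X 0 : MvPowerSeries (Fin 2) A) * MvPowerSeries.X 1 ^ 3) *
          V.formalGroupLaw

end WeierstrassCurve
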